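import Literature.NumberTheory.EllipticCurves.CoatesGreenberg1996.GoodModelKernelH1Trivial
import Literature.NumberTheory.EllipticCurves.UnramifiedCoboundaryInputs
import Mathlib.GroupTheory.GroupAction.Quotient
import HarnessLib

/-!
# The finite Galois-stable layer of the almost-étale argument: subgroups `G ∩ Gal(K̄_v/M)` of
# finite index, the orbit field `M(G • x)`, its `G`-stability and its pointwise stabiliser
# (Galois bookkeeping for the END `GoodModelKernelH1OfDeeplyRamified`)

HONEST FRAMING (BSD rank-`≤ 1` residual cell `b2b-bsdres`, home
`run/shared/lean/b2b/bsd-rank1-residual/`, team n1011, seat n1011-p05 GEN 9, row T-CG-DR, skeleton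
`cells/n1011/skel/T-CG-DR.md`): the cell deletes the COMBINATION-SHAPED residual classes of the
rank-`≤ 1` BSD formula from PUBLISHED theorems only and TYPES the construction-shaped ones;
research route, no claim beyond the stated classes, census output = EVIDENCE, nothing booked, no
mark moves. TOOL file (theorems only, no definition, no named fact): infinite Galois theory of
`K̄_v/K_v` (Krull topology, Mathlib `InfiniteGalois`) in the shape consumed by the derivation of
the Coates–Greenberg record from the trace form of "deeply ramified".

## Contents (all over `(absoluteGaloisGroup (v.adicCompletion K))_{K_v} = Gal(K̄_v/K_v)`, `K_v = v.adicCompletion K`)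

* `fixingSubgroup_comap_normal`, `finite_quotient_subgroupOf_fixingSubgroup` — for a finite NORMAL
  `M/K_v`, `Gal(K̄_v/M)` is normal in `(absoluteGaloisGroup (v.adicCompletion K))_{K_v}` and `G/(G ∩ Gal(K̄_v/M))` is finite for every
  `G ≤ (absoluteGaloisGroup (v.adicCompletion K))_{K_v}` (it embeds in `Aut(M/K_v)`).
* `finite_coords` — the coordinates of finitely many affine points form a finite set.
* `mem_iff_forall_smul_eq` — `z ∈ Kn ↔ z` is fixed by `Gal(K̄_v/Kn)` (`fixedField ∘ fixingSubgroup`).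
* `smul_mem_orbitLayer`, `smul_eq_self_of_mem_orbitLayer` — for `M` finite normal, `G ≤ (absoluteGaloisGroup (v.adicCompletion K))_{K_v}`,
  `U = G ∩ Gal(K̄_v/M)` and `x` fixed by `U`, the layer `Kn = M ⊔ K_v(q.out • x : q ∈ G/U)` is
  `G`-stable and fixed pointwise by `U`.

References: J. Neukirch, *ANT* IV §1 (Krull topology) [NeukirchANT1999]; Mathlib
`FieldTheory.Galois.Infinite`, `FieldTheory.KrullTopology`, `FieldTheory.Normal.Closure`.
-/

noncomputable section

open scoped Classical NNReal

open WeierstrassCurve NumberField IsDedekindDomain Field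
  Literature.NumberTheory.GaloisRepresentations Literature.NumberTheory.EllipticCurves
  IsDedekindDomain.HeightOneSpectrum

universe u

namespace Summit.BirchSwinnertonDyer.Rank1Residual.Additive.GoodModelLine.KernelH1

/-! ## §1 Finitely many points have finitely many coordinates -/

/-- The set of coordinates of the affine points in a finite set of points is finite. [folklore] -/
theorem finite_coords {F : Type*} [Field F] {V : WeierstrassCurve F} {Ps : Set V.toAffine.Point}
    (hPs : Ps.Finite) :
    {z | ∃ P ∈ Ps, ∃ x y, ∃ h : V.toAffine.Nonsingular x y, P = .some x y h ∧ (z = x ∨ z = y)}.Finite := by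
  have hsub : {z | ∃ P ∈ Ps, ∃ x y, ∃ h : V.toAffine.Nonsingular x y, P = .some x y h ∧ (z = x ∨ z = y)} ⊆
      ⋃ P ∈ Ps, {z | ∃ x y, ∃ h : V.toAffine.Nonsingular x y, P = .some x y h ∧ (z = x ∨ z = y)} := by
    intro z hz
    obtain ⟨P, hP, hrest⟩ := hz
    exact Set.mem_biUnion hP hrest
  refine Set.Finite.subset (Set.Finite.biUnion hPs fun P _ ↦ ?_) hsub
  rcases P with _ | ⟨x, y, h⟩
  · convert Set.finite_empty
    ext z
    simp only [Set.mem_setOf_eq, Set.mem_empty_iff_false, iff_false, not_exists]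
    intro x y h hh
    exact WeierstrassCurve.Affine.Point.some_ne_zero _ hh.1.symm
  · refine Set.Finite.subset (Set.toFinite ({x, y} : Set _)) fun z hz ↦ ?_
    obtain ⟨x', y', h', hP', hz⟩ := hz
    simp only [WeierstrassCurve.Affine.Point.some.injEq] at hP'
    obtain ⟨rfl, rfl⟩ := hP'
    rcases hz with rfl | rfl
    · exact Set.mem_insert _ _
    · exact Set.mem_insert_of_mem _ rfl

/-! ## §2 Galois bookkeeping in `(absoluteGaloisGroup (v.adicCompletion K))_{K_v}` -/

section Galois

variable {K : Type u} [Field K] [NumberField K] {v : HeightOneSpectrum (𝓞 K)}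

/-- The fixing subgroup of a NORMAL intermediate field `M/K_v` of `K̄_v`, viewed in `(absoluteGaloisGroup (v.adicCompletion K))_{K_v}`, is a
normal subgroup (it is the kernel of the restriction to `M`). [folklore] -/
theorem fixingSubgroup_comap_normal (M : IntermediateField (v.adicCompletion K) (AlgebraicClosure (v.adicCompletion K)))
    [Normal (v.adicCompletion K) M] : (M.fixingSubgroup.comap (absoluteGaloisGroup.toAlgEquiv (v.adicCompletion K)).toMonoidHom).Normal := by
  haveI : M.fixingSubgroup.Normal := by
    rw [← M.restrictNormalHom_ker]
    exact MonoidHom.normal_ker _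
  exact Subgroup.Normal.comap inferInstance _

/-- For a finite normal `M/K_v` inside `K̄_v` and any subgroup `G ≤ (absoluteGaloisGroup (v.adicCompletion K))_{K_v}`, the quotient
`G / (G ∩ Gal(K̄_v/M))` is finite (it embeds in `Aut(M/K_v)`). [folklore] -/
theorem finite_quotient_subgroupOf_fixingSubgroup (M : IntermediateField (v.adicCompletion K) (AlgebraicClosure (v.adicCompletion K)))
    [FiniteDimensional (v.adicCompletion K) M] [Normal (v.adicCompletion K) M] (G : Subgroup (absoluteGaloisGroup (v.adicCompletion K))) :
    Finite (G ⧸ (M.fixingSubgroup.comap (absoluteGaloisGroup.toAlgEquiv (v.adicCompletion K)).toMonoidHom).subgroupOf G) := by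
  set f : G →* (M ≃ₐ[v.adicCompletion K] M) :=
    (AlgEquiv.restrictNormalHom M).comp ((absoluteGaloisGroup.toAlgEquiv (v.adicCompletion K)).toMonoidHom.comp G.subtype) with hf
  have hker : f.ker = (M.fixingSubgroup.comap (absoluteGaloisGroup.toAlgEquiv (v.adicCompletion K)).toMonoidHom).subgroupOf G := by
    rw [hf, ← MonoidHom.comap_ker, M.restrictNormalHom_ker, ← Subgroup.comap_comap]
    rfl
  rw [← hker]
  exact Finite.of_equiv _ (QuotientGroup.quotientKerEquivRange f).symm.toEquiv

/-- **Galois descent to an intermediate field**: `z ∈ Kn` iff `z` is fixed by every `τ ∈ (absoluteGaloisGroup (v.adicCompletion K))_{K_v}`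
fixing `Kn` pointwise (`InfiniteGalois.fixedField_fixingSubgroup`). [folklore] -/
theorem mem_iff_forall_smul_eq (Kn : IntermediateField (v.adicCompletion K) (AlgebraicClosure (v.adicCompletion K))) (z : (AlgebraicClosure (v.adicCompletion K))) :
    z ∈ Kn ↔ ∀ τ : (absoluteGaloisGroup (v.adicCompletion K)), absoluteGaloisGroup.toAlgEquiv (v.adicCompletion K) τ ∈ Kn.fixingSubgroup → τ • z = z := by
  haveI := isGalois_algebraicClosure_adicCompletion (v := v)
  constructor
  · intro hz τ hτ
    rw [IntermediateField.mem_fixingSubgroup_iff] at hτ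
    exact hτ z hz
  · intro h
    rw [← InfiniteGalois.fixedField_fixingSubgroup Kn, IntermediateField.mem_fixedField_iff]
    intro f hf
    exact h ((absoluteGaloisGroup.toAlgEquiv (v.adicCompletion K)).symm f) (by rw [MulEquiv.apply_symm_apply]; exact hf)

/-- Every `k • x`, `k ∈ G`, is one of the `q.out • x`, `q ∈ G/U`, when `U = G ∩ Gal(K̄_v/M)` fixes
`x`. [folklore] -/
theorem smul_mem_range_out_smul (M : IntermediateField (v.adicCompletion K) (AlgebraicClosure (v.adicCompletion K))) (G : Subgroup (absoluteGaloisGroup (v.adicCompletion K)))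
    (x : (AlgebraicClosure (v.adicCompletion K))) (hxU : ∀ u ∈ M.fixingSubgroup.comap (absoluteGaloisGroup.toAlgEquiv (v.adicCompletion K)).toMonoidHom ⊓ G, u • x = x) (k : G) :
    (k : (absoluteGaloisGroup (v.adicCompletion K))) • x ∈ Set.range fun q : G ⧸ (M.fixingSubgroup.comap (absoluteGaloisGroup.toAlgEquiv (v.adicCompletion K)).toMonoidHom).subgroupOf G ↦
      ((q.out : G) : (absoluteGaloisGroup (v.adicCompletion K))) • x := by
  obtain ⟨u, hu⟩ := QuotientGroup.mk_out_eq_mul ((M.fixingSubgroup.comap (absoluteGaloisGroup.toAlgEquiv (v.adicCompletion K)).toMonoidHom).subgroupOf G) k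
  refine ⟨QuotientGroup.mk k, ?_⟩
  change (((QuotientGroup.mk k : G ⧸ _).out : G) : (absoluteGaloisGroup (v.adicCompletion K))) • x = _
  rw [hu, Subgroup.coe_mul, mul_smul, hxU u ⟨Subgroup.mem_subgroupOf.mp u.2, u.1.2⟩]

/-- **`G`-stability of the layer `Kn = M ⊔ K_v(G • x)`** (`M` normal, so `(absoluteGaloisGroup (v.adicCompletion K))`-stable; the orbit is
permuted by `G`). [folklore] -/
theorem smul_mem_orbitLayer (M : IntermediateField (v.adicCompletion K) (AlgebraicClosure (v.adicCompletion K)))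
    [Normal (v.adicCompletion K) M] (G : Subgroup (absoluteGaloisGroup (v.adicCompletion K))) (x : (AlgebraicClosure (v.adicCompletion K)))
    (hxU : ∀ u ∈ M.fixingSubgroup.comap (absoluteGaloisGroup.toAlgEquiv (v.adicCompletion K)).toMonoidHom ⊓ G, u • x = x) (g : G) {z : (AlgebraicClosure (v.adicCompletion K))}
    (hz : z ∈ M ⊔ IntermediateField.adjoin (v.adicCompletion K)
      (Set.range fun q : G ⧸ (M.fixingSubgroup.comap (absoluteGaloisGroup.toAlgEquiv (v.adicCompletion K)).toMonoidHom).subgroupOf G ↦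
        ((q.out : G) : (absoluteGaloisGroup (v.adicCompletion K))) • x)) :
    (g : (absoluteGaloisGroup (v.adicCompletion K))) • z ∈ M ⊔ IntermediateField.adjoin (v.adicCompletion K)
      (Set.range fun q : G ⧸ (M.fixingSubgroup.comap (absoluteGaloisGroup.toAlgEquiv (v.adicCompletion K)).toMonoidHom).subgroupOf G ↦
        ((q.out : G) : (absoluteGaloisGroup (v.adicCompletion K))) • x) := by
  set ĝ : (AlgebraicClosure (v.adicCompletion K)) ≃ₐ[v.adicCompletion K] (AlgebraicClosure (v.adicCompletion K)) := absoluteGaloisGroup.toAlgEquiv (v.adicCompletion K) (g : (absoluteGaloisGroup (v.adicCompletion K))) with hĝ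
  have hmap : (M ⊔ IntermediateField.adjoin (v.adicCompletion K)
      (Set.range fun q : G ⧸ (M.fixingSubgroup.comap (absoluteGaloisGroup.toAlgEquiv (v.adicCompletion K)).toMonoidHom).subgroupOf G ↦
        ((q.out : G) : (absoluteGaloisGroup (v.adicCompletion K))) • x)).map (ĝ : (AlgebraicClosure (v.adicCompletion K)) →ₐ[v.adicCompletion K] (AlgebraicClosure (v.adicCompletion K))) ≤
      M ⊔ IntermediateField.adjoin (v.adicCompletion K)
        (Set.range fun q : G ⧸ (M.fixingSubgroup.comap (absoluteGaloisGroup.toAlgEquiv (v.adicCompletion K)).toMonoidHom).subgroupOf G ↦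
          ((q.out : G) : (absoluteGaloisGroup (v.adicCompletion K))) • x) := by
    rw [IntermediateField.map_sup]
    refine sup_le_sup ((IntermediateField.normal_iff_forall_map_le'.mp inferInstance) ĝ) ?_
    rw [IntermediateField.adjoin_map]
    refine IntermediateField.adjoin.mono _ _ _ ?_
    rintro _ ⟨_, ⟨q, rfl⟩, rfl⟩
    change ĝ (((q.out : G) : (absoluteGaloisGroup (v.adicCompletion K))) • x) ∈ _
    rw [show ĝ (((q.out : G) : (absoluteGaloisGroup (v.adicCompletion K))) • x) = ((g * q.out : G) : (absoluteGaloisGroup (v.adicCompletion K))) • x by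
      rw [Subgroup.coe_mul, mul_smul]; rfl]
    exact smul_mem_range_out_smul M G x hxU _
  exact hmap ⟨z, hz, rfl⟩

/-- **The layer `Kn = M ⊔ K_v(G • x)` is fixed pointwise by `U = G ∩ Gal(K̄_v/M)`** (`M` normal, so
`Gal(K̄_v/M)` is normal in `(absoluteGaloisGroup (v.adicCompletion K))_{K_v}` and `U` fixes the whole orbit of `x`). [folklore] -/
theorem smul_eq_self_of_mem_orbitLayer (M : IntermediateField (v.adicCompletion K) (AlgebraicClosure (v.adicCompletion K)))
    [Normal (v.adicCompletion K) M] (G : Subgroup (absoluteGaloisGroup (v.adicCompletion K))) (x : (AlgebraicClosure (v.adicCompletion K)))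
    (hxU : ∀ u ∈ M.fixingSubgroup.comap (absoluteGaloisGroup.toAlgEquiv (v.adicCompletion K)).toMonoidHom ⊓ G, u • x = x) {u : (absoluteGaloisGroup (v.adicCompletion K))}
    (hu : u ∈ M.fixingSubgroup.comap (absoluteGaloisGroup.toAlgEquiv (v.adicCompletion K)).toMonoidHom ⊓ G) {z : (AlgebraicClosure (v.adicCompletion K))}
    (hz : z ∈ M ⊔ IntermediateField.adjoin (v.adicCompletion K)
      (Set.range fun q : G ⧸ (M.fixingSubgroup.comap (absoluteGaloisGroup.toAlgEquiv (v.adicCompletion K)).toMonoidHom).subgroupOf G ↦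
        ((q.out : G) : (absoluteGaloisGroup (v.adicCompletion K))) • x)) :
    u • z = z := by
  haveI hOn := fixingSubgroup_comap_normal M
  set H' : Subgroup ((AlgebraicClosure (v.adicCompletion K)) ≃ₐ[v.adicCompletion K] (AlgebraicClosure (v.adicCompletion K))) :=
    (M.fixingSubgroup.comap (absoluteGaloisGroup.toAlgEquiv (v.adicCompletion K)).toMonoidHom ⊓ G).comap (absoluteGaloisGroup.toAlgEquiv (v.adicCompletion K)).symm.toMonoidHom with hH'def
  have hH'_mem : ∀ f, f ∈ H' ↔ (absoluteGaloisGroup.toAlgEquiv (v.adicCompletion K)).symm f ∈ M.fixingSubgroup.comap (absoluteGaloisGroup.toAlgEquiv (v.adicCompletion K)).toMonoidHom ⊓ G :=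
    fun _ ↦ Subgroup.mem_comap
  have hle : M ⊔ IntermediateField.adjoin (v.adicCompletion K)
      (Set.range fun q : G ⧸ (M.fixingSubgroup.comap (absoluteGaloisGroup.toAlgEquiv (v.adicCompletion K)).toMonoidHom).subgroupOf G ↦
        ((q.out : G) : (absoluteGaloisGroup (v.adicCompletion K))) • x) ≤ IntermediateField.fixedField H' := by
    refine sup_le ?_ ?_
    · rw [IntermediateField.le_iff_le]
      intro f hf
      have h1 : (absoluteGaloisGroup.toAlgEquiv (v.adicCompletion K)).symm f ∈ M.fixingSubgroup.comap (absoluteGaloisGroup.toAlgEquiv (v.adicCompletion K)).toMonoidHom := ((hH'_mem f).mp hf).1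
      rw [Subgroup.mem_comap, MulEquiv.coe_toMonoidHom, MulEquiv.apply_symm_apply] at h1
      exact h1
    · rw [IntermediateField.adjoin_le_iff]
      rintro _ ⟨q, rfl⟩
      rw [SetLike.mem_coe, IntermediateField.mem_fixedField_iff]
      intro f hf
      set τ : (absoluteGaloisGroup (v.adicCompletion K)) := (absoluteGaloisGroup.toAlgEquiv (v.adicCompletion K)).symm f with hτdef
      obtain ⟨hτO, hτG⟩ := (hH'_mem f).mp hf
      change τ • (((q.out : G) : (absoluteGaloisGroup (v.adicCompletion K))) • x) = _
      have hconj : ((q.out : G) : (absoluteGaloisGroup (v.adicCompletion K)))⁻¹ * τ * ((q.out : G) : (absoluteGaloisGroup (v.adicCompletion K))) ∈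
          M.fixingSubgroup.comap (absoluteGaloisGroup.toAlgEquiv (v.adicCompletion K)).toMonoidHom ⊓ G :=
        ⟨hOn.conj_mem' τ hτO _, G.mul_mem (G.mul_mem (G.inv_mem (q.out).2) hτG) (q.out).2⟩
      have := hxU _ hconj
      rw [mul_smul, mul_smul, inv_smul_eq_iff] at this
      exact this
  have hz' := hle hz
  rw [IntermediateField.mem_fixedField_iff] at hz'
  have hmem : absoluteGaloisGroup.toAlgEquiv (v.adicCompletion K) u ∈ H' := by
    rw [hH'_mem, MulEquiv.symm_apply_apply]
    exact hu
  exact hz' _ hmem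

/-- A change of variables is fixed by a ring endomorphism fixing its four entries. [folklore] -/
theorem variableChange_map_eq_of_apply_eq {R : Type*} [CommRing R] (C : VariableChange R)
    (f : R →+* R) (hu : f (C.u : R) = C.u) (hr : f C.r = C.r) (hs : f C.s = C.s)
    (ht : f C.t = C.t) : C.map f = C := by
  rcases C with ⟨u₀, r₀, s₀, t₀⟩
  simp only [VariableChange.map, VariableChange.mk.injEq]
  exact ⟨Units.ext hu, hr, hs, ht⟩

/-- **A relatively open neighbourhood of `1` in `G ≤ Γ_{K_v}` contains `G ∩ Gal(K̄_v/L₀)` for a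
finite normal `L₀/K_v`** (Krull topology, `krullTopology_mem_nhds_one_iff_of_normal`). [folklore] -/
theorem exists_normal_fixingSubgroup_subset (G : Subgroup (absoluteGaloisGroup (v.adicCompletion K)))
    {Z : Set G} (hZ : IsOpen Z) (h1 : (1 : G) ∈ Z) :
    ∃ L₀ : IntermediateField (v.adicCompletion K) (AlgebraicClosure (v.adicCompletion K)),
      FiniteDimensional (v.adicCompletion K) L₀ ∧ Normal (v.adicCompletion K) L₀ ∧
      ∀ u : G, absoluteGaloisGroup.toAlgEquiv (v.adicCompletion K) (u : absoluteGaloisGroup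
        (v.adicCompletion K)) ∈ L₀.fixingSubgroup → u ∈ Z := by
  haveI := isGalois_algebraicClosure_adicCompletion (v := v)
  obtain ⟨t, htopen, ht⟩ := isOpen_induced_iff.mp hZ
  have h1t : (1 : absoluteGaloisGroup (v.adicCompletion K)) ∈ t := by
    have : (1 : G) ∈ Subtype.val ⁻¹' t := by rw [ht]; exact h1
    exact this
  obtain ⟨L₀, hL₀fin, hL₀normal, hL₀sub⟩ :=
    (krullTopology_mem_nhds_one_iff_of_normal (v.adicCompletion K)
      (AlgebraicClosure (v.adicCompletion K)) t).mp (htopen.mem_nhds h1t)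
  refine ⟨L₀, hL₀fin, hL₀normal, fun u hu ↦ ?_⟩
  have h2 : u ∈ Subtype.val ⁻¹' t := hL₀sub hu
  rw [ht] at h2
  exact h2

end Galois

end Summit.BirchSwinnertonDyer.Rank1Residual.Additive.GoodModelLine.KernelH1

end
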